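import Mathlib.NumberTheory.Height.NumberField
import Mathlib.Algebra.Order.Antidiag.Finsupp
import Mathlib.RingTheory.MvPolynomial.Homogeneous
import HarnessLib

/-!
# Roy's small value estimate for `𝔾ₐ × 𝔾ₘ` — the height of the Veronese image of a point

Topic `Literature/NumberTheory/Transcendental`. Part of the formalisation of the proof of Roy 2013,
Theorem 1.1 (named fact `roy2013_thm_1_1`, `RoySmallValueEstimates.lean`). Source: D. Roy,
*A small value estimate for `𝔾ₐ × 𝔾ₘ`*, Mathematika 59 (2013) 333–363 = arXiv:1301.0663, §2,
Lemma 2.1 (p. 6 of the arXiv text) and §6, proof of Proposition 6.4: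

> **Lemma 2.1.** [...] `|h_𝓑(Z) − D^{t+1} h(Z)| ≤ (t+4)(t+1) log(m+1) D^{t+1} deg(Z)`.
> [...] `DT h(Z) ≤ T h_𝓑(Z) + 4 log(3) DT deg(Z)` [...]

Comparing the height of a zero-dimensional `Z` "in degree `D`" with `D` times its standard
height is, point by point, the comparison of the height of the vector `(α^ν)_{|ν| = D}` of all
monomials of degree `D` in the coordinates of a point `α` (the coefficient vector of the linear form
`R ↦ R(α)` on `ℂ[X]_D`) with the height of `α`. With Mathlib's height (`Height.mulHeight`,
relative to the admissible absolute values of a number field) the comparison is EXACT: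
**`H((a^ν)_{|ν|=D}) = H(a)^D`** (`mulHeight_veronese`, `logHeight_veronese`), because at every
place `max_ν |a^ν|_v = (max_k |a_k|_v)^D`. We deduce it from Mathlib's `mulHeight_fun_prod_eq`
(height of a "multiplication table") by comparing the Veronese vector with the table of all
products of `D` coordinates in both directions (`mulHeight_comp_le`). Everything is proved; no
named facts.

## References

* [Roy2013] D. Roy, *A small value estimate for 𝔾ₐ × 𝔾ₘ*, Mathematika 59 (2013), 333–363
  (arXiv:1301.0663), Lemma 2.1 and §6, proof of Proposition 6.4 (comparison `h_𝓑` vs `D h`).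
-/

noncomputable section

open Finset Height

namespace Literature.NumberTheory.Transcendental

namespace Roy2013

/-! ### Words and exponents -/

/-- The exponent vector of a word `I : Fin D → Fin 3` (letter counts). [folklore] -/
def wordExp {D : ℕ} (I : Fin D → Fin 3) : ↥(finsuppAntidiag (univ : Finset (Fin 3)) D) :=
  ⟨∑ a, Finsupp.single (I a) 1, by
    rw [mem_finsuppAntidiag]
    refine ⟨?_, subset_univ _⟩
    rw [← Finsupp.degree_eq_sum, map_sum]
    simp [Finsupp.degree_single]⟩

/-- Every exponent vector of degree `D` is the letter count of some word of length `D`. [folklore] -/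
theorem exists_word : ∀ (D : ℕ) (ν : Fin 3 →₀ ℕ), ν.degree = D →
    ∃ I : Fin D → Fin 3, ∑ a, Finsupp.single (I a) 1 = ν := by
  intro D
  induction D with
  | zero =>
    intro ν hν
    refine ⟨Fin.elim0, ?_⟩
    rw [Finsupp.degree_eq_zero_iff] at hν
    simp [hν]
  | succ D ih =>
    intro ν hν
    -- some letter occurs
    obtain ⟨k, hk⟩ : ∃ k, ν k ≠ 0 := by
      by_contra h0
      have hν0 : ν = 0 := Finsupp.ext fun k => by simpa using not_exists.mp h0 k
      rw [hν0, map_zero] at hν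
      exact Nat.succ_ne_zero D hν.symm
    have hle : Finsupp.single k 1 ≤ ν := Finsupp.single_le_iff.mpr (Nat.one_le_iff_ne_zero.mpr hk)
    have hdeg : (ν - Finsupp.single k 1).degree = D := by
      have h1 : (ν - Finsupp.single k 1).degree + (Finsupp.single k 1).degree = ν.degree := by
        rw [← map_add, tsub_add_cancel_of_le hle]
      rw [Finsupp.degree_single, hν] at h1
      omega
    obtain ⟨I, hI⟩ := ih _ hdeg
    refine ⟨Fin.cons k I, ?_⟩
    rw [Fin.sum_univ_succ, Fin.cons_zero]
    simp only [Fin.cons_succ]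
    rw [hI, add_comm, tsub_add_cancel_of_le hle]

/-- Elements of `finsuppAntidiag univ D` have degree `D`. [folklore] -/
theorem degree_of_mem_antidiag {D : ℕ} (ν : ↥(finsuppAntidiag (univ : Finset (Fin 3)) D)) :
    ν.1.degree = D := by
  have h := ν.2; rw [mem_finsuppAntidiag] at h; rw [Finsupp.degree_eq_sum]; exact h.1

/-- A word with prescribed letter counts. [folklore] -/
def word {D : ℕ} (ν : ↥(finsuppAntidiag (univ : Finset (Fin 3)) D)) : Fin D → Fin 3 :=
  Classical.choose (exists_word D ν.1 (degree_of_mem_antidiag ν))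

/-- Its letter counts. [folklore] -/
theorem wordExp_word {D : ℕ} (ν : ↥(finsuppAntidiag (univ : Finset (Fin 3)) D)) :
    wordExp (word ν) = ν :=
  Subtype.ext (Classical.choose_spec (exists_word D ν.1 (degree_of_mem_antidiag ν)))

/-! ### The Veronese vector and the multiplication table -/

variable {K : Type*} [Field K]

/-- The value of the monomial with exponent the letter count of `I` is the product of the letters'
values. [folklore] -/
theorem prod_pow_wordExp {D : ℕ} (a : Fin 3 → K) (I : Fin D → Fin 3) :
    (∏ k, a k ^ ((wordExp I).1 k)) = ∏ j, a (I j) := by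
  classical
  simp only [wordExp, Finsupp.coe_finsetSum, Finset.sum_apply]
  rw [show (∏ k, a k ^ ∑ j, (Finsupp.single (I j) 1 : Fin 3 →₀ ℕ) k) =
      ∏ k, ∏ j, a k ^ ((Finsupp.single (I j) 1 : Fin 3 →₀ ℕ) k) from
    Finset.prod_congr rfl fun k _ => (Finset.prod_pow_eq_pow_sum _ _ _).symm, Finset.prod_comm]
  refine Finset.prod_congr rfl fun j _ => ?_
  rw [Finset.prod_eq_single (I j) (fun k _ hk => by
    rw [Finsupp.single_apply, if_neg (Ne.symm hk), pow_zero]) (fun h => absurd (mem_univ _) h),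
    Finsupp.single_eq_same, pow_one]

variable [NumberField K]

/-- **The height of the Veronese vector**: `H((a^ν)_{|ν| = D}) = H(a)^D`.
[cite: Roy2013, Lemma 2.1 (comparison of `h_𝓑(Z)` with `D^{t+1} h(Z)`, here exact for `t = 0`)] -/
theorem mulHeight_veronese {D : ℕ} (a : Fin 3 → K) (ha : a ≠ 0) :
    mulHeight (fun ν : ↥(finsuppAntidiag (univ : Finset (Fin 3)) D) => ∏ k, a k ^ (ν.1 k)) =
      mulHeight a ^ D := by
  set ver : ↥(finsuppAntidiag (univ : Finset (Fin 3)) D) → K := fun ν => ∏ k, a k ^ (ν.1 k)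
    with hver
  set T : (Fin D → Fin 3) → K := fun I => ∏ j, a (I j) with hT
  have hTH : mulHeight T = mulHeight a ^ D := by
    rw [hT, mulHeight_fun_prod_eq (x := fun _ : Fin D => a) (fun _ => ha), prod_const, card_univ,
      Fintype.card_fin]
  have h1 : T = ver ∘ wordExp := funext fun I => by
    simp only [hT, hver, Function.comp_apply, prod_pow_wordExp]
  have h2 : ver = T ∘ word := funext fun ν => by
    simp only [hT, hver, Function.comp_apply, ← prod_pow_wordExp, wordExp_word]
  refine le_antisymm ?_ ?_
  · rw [← hTH, h2]; exact mulHeight_comp_le _ _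
  · rw [← hTH, h1]; exact mulHeight_comp_le _ _

/-- Logarithmic form: `h((a^ν)_{|ν| = D}) = D · h(a)`. [cite: Roy2013, Lemma 2.1] -/
theorem logHeight_veronese {D : ℕ} (a : Fin 3 → K) (ha : a ≠ 0) :
    logHeight (fun ν : ↥(finsuppAntidiag (univ : Finset (Fin 3)) D) => ∏ k, a k ^ (ν.1 k)) =
      D * logHeight a := by
  rw [logHeight_eq_log_mulHeight, mulHeight_veronese a ha, Real.log_pow, logHeight_eq_log_mulHeight]

end Roy2013

end Literature.NumberTheory.Transcendental
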